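import Summits.QuantumFields.YangMills.Theorems.SwapTwistDeficitTwistTraceSpectral
import HarnessLib

/-!
# A-priori bounds for the swap-twisted and the two-insertion zero-flux thermal traces: `|Z^S| ≤ Z`, `0 ≤ Z − Z^S ≤ 2Z`, `0 ≤ insTrace`

Record module for the crux `SwapTwistDeficit.TwistDeficit` (stmt-QuantumFields-23317; D-0145 LINE g10-B of seat ym-idea-4) and its sister line
`SlowBitWindow`: the elementary consequences of the spectral representations `twistTrace_spectral` ∕ `insTrace_spectral` that the route texts use as
sanity facts («RP yields only Z^S ≤ Z, so nothing is free»; the deficit `Z − Z^S = 2 Z_odd` lies in `[0, 2Z]`; insertion traces are non-negative):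

* `abs_twistTrace_le_physTrace` — `|twistTrace L β T| ≤ physTrace L β T` (`β ≥ 1`, `T ≥ 3`);
* `physTrace_sub_twistTrace_nonneg`, `physTrace_sub_twistTrace_le` — `0 ≤ Z(T) − Z^S(T) ≤ 2 Z(T)`;
* `insTrace_nonneg` — `0 ≤ insTrace L β O m` for physical bounded `O`, `1 ≤ m ≤ 2L − 2`.

HONEST FRAMING: fixed-lattice transfer-matrix bookkeeping; no summit, no mass gap, nothing about infinite volume or the continuum is proved here.
References: [cite: tHooft1979Flux]; [cite: ReedSimonIV1978, Thm. XIII.1]; [cite: MontvayMunster1994, (3.145)].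
-/

set_option autoImplicit false

noncomputable section

open MeasureTheory Filter Topology Function
open Literature.MathematicalPhysics.QuantumFieldTheory
open Literature.MathematicalPhysics.QuantumLattice
open Literature.Analysis.OperatorTheory.YMMatrixModel
open scoped BigOperators

namespace Summit.QuantumFields.YangMills.Theorems.FemtoTransferGap.TT

open Summit.QuantumFields.YangMills.Theorems.FemtoTransferGap

variable {L : ℕ} [NeZero L]

/-- **`|Z^S_phys(T)| ≤ Z_phys(T)`** for `β ≥ 1`, `T ≥ 3`: the swap overlaps `d_k = ∫ e_k (e_k ∘ S)` have modulus `≤ 1`. [cite: tHooft1979Flux]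
[cite: ReedSimonIV1978, Thm. XIII.1] -/
theorem abs_twistTrace_le_physTrace {β : ℝ} (hβ : 1 ≤ β) {T : ℕ} (hT : 3 ≤ T) :
    |twistTrace L β T| ≤ physTrace L β T := by
  have hβ0 : 0 < β := zero_lt_one.trans_le hβ
  obtain ⟨e, -, -, -, -, hdle, -, hsum⟩ := twistTrace_spectral (L := L) hβ0
  have hZ : HasSum (fun k => levelValue su2Rep L β k ^ T) (physTrace L β T) := traceFormula L β T hβ (by omega)
  have hS := hsum T hT
  have h1 : twistTrace L β T ≤ physTrace L β T := by
    refine hasSum_le (fun k => ?_) hS hZ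
    have h0 : 0 ≤ levelValue su2Rep L β k ^ T := pow_nonneg (levelValue_su2Rep_pos hβ0 k).le T
    have hd := (abs_le.mp (hdle k)).2
    nlinarith
  have h2 : -physTrace L β T ≤ twistTrace L β T := by
    refine hasSum_le (fun k => ?_) hZ.neg hS
    have h0 : 0 ≤ levelValue su2Rep L β k ^ T := pow_nonneg (levelValue_su2Rep_pos hβ0 k).le T
    have hd := (abs_le.mp (hdle k)).1
    nlinarith
  exact abs_le.mpr ⟨h2, h1⟩

/-- `Z^S_phys(T) ≤ Z_phys(T)`. [cite: tHooft1979Flux] -/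
theorem twistTrace_le_physTrace {β : ℝ} (hβ : 1 ≤ β) {T : ℕ} (hT : 3 ≤ T) : twistTrace L β T ≤ physTrace L β T :=
  (le_abs_self _).trans (abs_twistTrace_le_physTrace hβ hT)

/-- `0 ≤ Z_phys(T) − Z^S_phys(T)` (twice the thermal weight of the swap-odd sector). [cite: tHooft1979Flux] -/
theorem physTrace_sub_twistTrace_nonneg {β : ℝ} (hβ : 1 ≤ β) {T : ℕ} (hT : 3 ≤ T) : 0 ≤ physTrace L β T - twistTrace L β T :=
  sub_nonneg.mpr (twistTrace_le_physTrace hβ hT)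

/-- `Z_phys(T) − Z^S_phys(T) ≤ 2 Z_phys(T)`. [cite: tHooft1979Flux] -/
theorem physTrace_sub_twistTrace_le {β : ℝ} (hβ : 1 ≤ β) {T : ℕ} (hT : 3 ≤ T) :
    physTrace L β T - twistTrace L β T ≤ 2 * physTrace L β T := by
  have h := (abs_le.mp (abs_twistTrace_le_physTrace (L := L) hβ hT)).1
  linarith

/-- **`0 ≤ insTrace L β O m`** for `β ≥ 1`, a physical `O` with `|O| ≤ C_O` and `1 ≤ m ≤ 2L − 2`: every term of the double spectral sum
`Σ λ_k^{2L-m} λ_l^m (∫ O e_k e_l)²` is non-negative. [cite: MontvayMunster1994, (3.145)] -/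
theorem insTrace_nonneg {β : ℝ} (hβ : 1 ≤ β) {O : GaugeConfig 3 L SU2 → ℝ} (hO : IsPhys O) {CO : ℝ} (hOb : ∀ U, |O U| ≤ CO)
    {m : ℕ} (hm : 1 ≤ m) (hmL : m + 2 ≤ 2 * L) : 0 ≤ insTrace L β O m := by
  have hβ0 : 0 < β := zero_lt_one.trans_le hβ
  obtain ⟨e, -, -, -, -, -, hsum⟩ := insTrace_spectral (L := L) hβ0 hO hOb
  exact (hsum m hm hmL).nonneg fun p =>
    mul_nonneg (mul_nonneg (pow_nonneg (levelValue_su2Rep_pos hβ0 _).le _) (pow_nonneg (levelValue_su2Rep_pos hβ0 _).le _)) (sq_nonneg _)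

end Summit.QuantumFields.YangMills.Theorems.FemtoTransferGap.TT

end
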